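import Summits.BirchSwinnertonDyer.BirchSwinnertonDyer.Theorems.QuadraticBranchSignedControlPlusEtaNonsurjRankLeOneLeaf
import HarnessLib

/-!
# Route `QuadraticBranchSignedControl` (rung K8, cell `bsd-potss`), crux stmt-BirchSwinnertonDyer-19606
# `PlusEtaMainConjectureNonsurj`: Part LIII-bis — THE RESTRICTED GLUE FOR THE NON-CM η-INPUT AND THE `F`-FORM SPLIT CERTIFICATE
# (the item-tree shape 19606_nc → 19243_nc → `closes`, with O10 beside it)

WHY. Part LIII split the rank-≤1 face of the crux at the leaf into the non-CM η-input (`hNnc`, η-form) and O10. A planner who files the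
non-CM η-item in the lineage's usual shape (η-child → glue → `F`-form parent → `closes`) needs the Theorems-side proof of the restricted GLUE
(η-form ⟹ `F`-form on non-CM rows with a rank-≤1 partner) and the certificate that the leaf re-elaborates from the `F`-form non-CM face + O10
+ bsd.S28. Both are Part L §6 / Part LIII §3 with one more binder threaded; they are landed here so that the candidate items' `_proof`s are
one-liners (this seat's planner material `k8eta-c2/g35/plan/`).

* §1 `plusMainConjectureNonsurjBranchNonCMRankLeOne_of_eta` — the restricted glue (shape of item 19609): non-CM rank-≤1 η-face ⟹
  (`EtaDescentFrameNonsurj` ⟹ Kobayashi Thm 1.2 ⟹) non-CM rank-≤1 `F`-form face.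
* §2 `o5SharpGss_of_closesBinders_of_nonsurjNonCMRankLeOne_of_cmRankOneBSDp` — the leaf from `closes`' binders + bsd.S28 with hN replaced by
  the `F`-form non-CM rank-≤1 face + O10; and `…_etaNonCM…'` — Part LIII §3 re-derived as §2 ∘ §1 (agreement).

HONEST FRAMING (cell `bsd-potss`, run/shared/lean/pub/bsd-potss/; FULL-BSD rank ≤ 1 programme, HUMAN RULING D-0036/D-0074): RE-ASSEMBLY
THEOREMS ONLY — no definition, no new named fact, no `sorry`, axioms standard; CONDITIONAL on the displayed route binders and the two OPEN
inputs (η-main conjecture on non-CM non-onto rows; O10). Nothing is closed, filed or re-typed; `BSD(W, p)` is claimed for no pair. Seat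
`bsd-potss-k8eta-c2` g35 (prover), `--supports stmt-BirchSwinnertonDyer-19606`.

References: [Kobayashi2003] Thm. 1.2 (p. 2), §4 (p. 8), Thm. 7.4 (p. 13); [GreenbergLNM1716] §3; [KitajimaOtsuki2018] Main Thm. 1.3;
[Mazur1978] Cor. 4.1; [BurungaleFlach2024] Thm 1.1, Cor. 2; [Miller2011LMS] Def. 1.1.
-/

set_option autoImplicit false
set_option linter.dupNamespace false

noncomputable section

open scoped Classical MatrixGroups ModularForm

open CongruenceSubgroup Field WeierstrassCurve
open Literature.NumberTheory.EllipticCurves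
open Literature.NumberTheory.EllipticCurves.ModularForms
open Literature.NumberTheory.EllipticCurves.Kobayashi2003
open Literature.NumberTheory.EllipticCurves.Rank1Residual
open Literature.NumberTheory.EllipticCurves.Rank1Residual.Typed
open Literature.NumberTheory.GaloisRepresentations
open Literature.NumberTheory.GaloisCohomology
open Summit.BirchSwinnertonDyer.Rank1Residual.Additive
open Summit.BirchSwinnertonDyer.BirchSwinnertonDyer.Theses.QuadraticBranchSignedControl

namespace Summit.BirchSwinnertonDyer.BirchSwinnertonDyer.Theorems

namespace EtaRankLeOneLeafGlue

/-! ## §1 The restricted glue for the non-CM η-input -/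

/-- **The restricted glue for the NON-CM η-input (shape of item 19609 `PlusMainConjectureNonsurjBranchOfEta`, row by row, with the two
binders `¬ V.HasCM` and `∃ W …, r_an(W) ≤ 1` threaded)**: the non-CM rank-≤1 face of the η-crux (text `hNnc` of Part LIII §3) ⟹
(`EtaDescentFrameNonsurj` ⟹ Kobayashi Thm 1.2 ⟹) the non-CM rank-≤1 face of the `F`-form parent `PlusMainConjectureNonsurjBranch` (item
19243's text + the same two binders). Same proof as the glue of record and Part L §6 (the seam
`quadraticBranchPlusMainConjectureAt_of_etaPlusMainConjecture_of_decomposition` at `K₀ = ℚ(ζ_p)` with the sign character of `√p*`).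
CONDITIONAL; nothing booked; no item is filed here. [cite: Kobayashi2003, Thm. 1.2 (p. 2), §4 Even main conjecture (p. 8)]
[cite: GreenbergLNM1716, §3 (prime-to-p descent)] -/
theorem plusMainConjectureNonsurjBranchNonCMRankLeOne_of_eta
    (hNnc : ∀ (V : WeierstrassCurve ℚ) [V.IsElliptic] [V.IsGloballyMinimal] (p : ℕ) [Fact p.Prime],
      5 ≤ p → V.HasGoodReductionAtPrime p → V.frobeniusTrace p = 0 →
      ¬ (∀ m : ℕ, V.HasSurjectiveModNGaloisRep (p ^ m : ℕ)) → ¬ V.HasCM →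
      (∃ (W : WeierstrassCurve ℚ) (_ : W.IsElliptic) (_ : W.IsGloballyMinimal) (C : VariableChange ℚ),
          C • W.quadraticTwist ((-1 : ℚ) ^ (p / 2) * p) = V ∧ W.analyticRank ≤ 1) →
      QuadraticBranchPlusEtaMainConjectureAt V p)
    (hdec : EtaDescentFrameNonsurj) (h12 : PublishedInputKobThm12Nonsurj) :
    ∀ (V : WeierstrassCurve ℚ) [V.IsElliptic] [V.IsGloballyMinimal] (p : ℕ) [Fact p.Prime],
      5 ≤ p → V.HasGoodReductionAtPrime p → V.frobeniusTrace p = 0 →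
      ¬ (∀ m : ℕ, V.HasSurjectiveModNGaloisRep (p ^ m : ℕ)) → ¬ V.HasCM →
      (∃ (W : WeierstrassCurve ℚ) (_ : W.IsElliptic) (_ : W.IsGloballyMinimal) (C : VariableChange ℚ),
          C • W.quadraticTwist ((-1 : ℚ) ^ (p / 2) * p) = V ∧ W.analyticRank ≤ 1) →
      QuadraticBranchPlusMainConjectureAt V p := by
  intro V _ _ p _ hp5 hgood hap hns hCM hW
  have hp2 : p ≠ 2 := by omega
  haveI : NeZero p := ⟨(Fact.out : p.Prime).ne_zero⟩
  haveI : IsCyclotomicExtension {p} ℚ (CyclotomicField p ℚ) :=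
    CyclotomicField.isCyclotomicExtension p ℚ
  haveI : (galRange (K := ℚ) (CyclotomicField p ℚ)).Normal := normal_galRange_cyclotomic p _
  obtain ⟨θ, ηq, -, -, -, hηK, hη1⟩ := SignedTwist.exists_theta_eta_cyclotomicField p hp2
  exact quadraticBranchPlusMainConjectureAt_of_etaPlusMainConjecture_of_decomposition h12
    (CyclotomicField p ℚ) ηq
    (fun κ γ hκ hγ hγK hγc F _ _ V' _ κF γF hF hθ hC' hκF hγF hζ =>
      hdec p hp5 (CyclotomicField p ℚ) ηq hηK hη1 V hgood hap hns κ γ hκ hγ hγK hγc F V' κF γF hF hθ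
        hC' hκF hγF hζ)
    (fun hp2' hgood' hap' hf ϖ hϖ Lη hL κ γ hκ hγ hγK hγc D =>
      hNnc V p hp5 hgood hap hns hCM hW (CyclotomicField p ℚ) ηq hηK hη1 hp2' hgood' hap' hf ϖ hϖ Lη hL κ γ
        hκ hγ hγK hγc D)

/-! ## §2 The `F`-form split certificate and its agreement with Part LIII §3 -/

/-- **The leaf from `closes`' binders + bsd.S28 with hN replaced by the `F`-FORM non-CM rank-≤1 face + O10** (Part L §6's `F`-form
certificate with the CM pairs served by bsd.S28 (`r_an = 0`) and O10 (`r_an = 1`) exactly as in Part LIII §3): for a planner who keeps the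
item tree 19606_nc → (glue §1) → 19243_nc → `closes`. Onto twins by the FE-free Kato consumer; non-onto twins of a non-CM partner are non-CM
(`j`). CONDITIONAL; nothing booked. [cite: Kobayashi2003, §4 (p. 8), Thm. 7.4 (p. 13)] [cite: KitajimaOtsuki2018, Main Thm. 1.3]
[cite: Mazur1978, Cor. 4.1] [cite: BurungaleFlach2024, Thm 1.1 and Cor. 2] [cite: Miller2011LMS, §1 and Def. 1.1] -/
theorem o5SharpGss_of_closesBinders_of_nonsurjNonCMRankLeOne_of_cmRankOneBSDp
    (hKoN : PlusKatoDivisibilityBranchOntoIotaOfNamedInputs) (h12 : PublishedInputKobThm12OntoIota)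
    (hZc : PublishedInputKobZetaEtaContraOnto) (hQc : PublishedInputKatoThm134ContraOnto) (hE : PlusLowerInclusionSurjBranch)
    (hN₁nc : ∀ (V : WeierstrassCurve ℚ) [V.IsElliptic] [V.IsGloballyMinimal] (p : ℕ) [Fact p.Prime],
      5 ≤ p → V.HasGoodReductionAtPrime p → V.frobeniusTrace p = 0 →
      ¬ (∀ m : ℕ, V.HasSurjectiveModNGaloisRep (p ^ m : ℕ)) → ¬ V.HasCM →
      (∃ (W : WeierstrassCurve ℚ) (_ : W.IsElliptic) (_ : W.IsGloballyMinimal) (C : VariableChange ℚ),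
          C • W.quadraticTwist ((-1 : ℚ) ^ (p / 2) * p) = V ∧ W.analyticRank ≤ 1) →
      QuadraticBranchPlusMainConjectureAt V p)
    (hO10 : ∀ (W : WeierstrassCurve ℚ) [W.IsElliptic] [W.IsGloballyMinimal] (p : ℕ) [Fact p.Prime],
      W.HasCM → W.analyticRank = 1 → 5 ≤ p → Addv W p → SubGss W p → MissingPPartAt W p)
    (hS28 : bsdTriple_of_hasCM_of_L_one_ne_zero)
    (h₂ : EtaTransportSigned) (h₄ : PAdicGrossZagierBranch)
    (hP : PublishedInputsGss2) (hKO : PublishedInputKO13) (hR : Gss2AtThree) :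
    Summit.BirchSwinnertonDyer.Rank1Residual.Additive.O5SharpGss := by
  -- (R2±) from Kitajima–Otsuki 2018 Main Thm. 1.3 — as in `closes`
  have h₃a : NoFiniteSubmodulePlus := fun W _ _ p _ hp5 =>
    Summit.BirchSwinnertonDyer.Rank1Residual.Additive.SignedTwist.evenBranchPlusNoFiniteSubmoduleAt_of_kitajimaOtsuki13PlusEta W p
      fun K₀ _ _ _ _ ηq hηK V _ _ hp2 hgood hap κ γ hκ hγ hγK D hfin htor M hM =>
        hKO p K₀ ηq hηK V hp2 hgood hap κ γ hκ hγ hγK 1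
          { X := D.X
            addCommGroup := D.addCommGroup
            module := D.module
            conj_mem := D.conj_mem
            toDual := D.toDual
            bijective := D.bijective
            toDual_T_smul := D.toDual_T_smul
            toDual_C_smul := D.toDual_C_smul }
          hfin htor M hM
  have h₃b : NoFiniteSubmoduleMinus := fun W _ _ p _ hp5 =>
    Summit.BirchSwinnertonDyer.Rank1Residual.Additive.SignedTwist.oddBranchStrictMinusNoFiniteSubmoduleAt_of_kitajimaOtsuki13MinusEta W p
      fun K₀ _ _ _ _ ηq hηK V _ _ hp2 hgood hap κ γ hκ hγ hγK D hfin htor M hM =>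
        hKO p K₀ ηq hηK V hp2 hgood hap κ γ hκ hγ hγK (-1)
          { X := D.X
            addCommGroup := D.addCommGroup
            module := D.module
            conj_mem := D.conj_mem
            toDual := D.toDual
            bijective := D.bijective
            toDual_T_smul := D.toDual_T_smul
            toDual_C_smul := D.toDual_C_smul }
          hfin htor M hM
  have h₃ : NoFiniteSubmoduleSigned := fun W _ _ p _ hp => ⟨h₃a W p hp, h₃b W p hp⟩
  intro W _ _ p hp hr hp2 hadd hGss
  by_cases hp3 : p = 3
  · subst hp3
    exact hR W hr hadd hGss
  · have hp5 : 5 ≤ p := hp.out.five_le_of_ne_two_of_ne_three hp2 hp3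
    obtain ⟨hGZK, hmod, hnf, hGZ, hPT, hM⟩ := hP
    by_cases hCM : W.HasCM
    · rcases Nat.le_one_iff_eq_zero_or_eq_one.mp hr with h0 | h1
      · exact EtaRankLeOneLeaf.missingPPartAt_of_hasCM_of_analyticRank_eq_zero hmod hS28 W p hCM h0
      · exact hO10 W p hCM h1 hp5 hadd hGss
    · refine EtaRankLeOneFace.missingPPartAt_of_plusMCAtTwin_of_mazur hGZK hmod hnf hGZ hPT hM h₂ h₃ h₄ W p ?_ hr hp5 hadd hGss
      intro V _ _ C hCV hgood hap
      by_cases hs : ∀ m : ℕ, V.HasSurjectiveModNGaloisRep (p ^ m : ℕ)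
      · exact Summit.BirchSwinnertonDyer.Rank1Residual.Additive.quadraticBranchPlusMainConjectureAt_of_katoDivisibilityIota_of_lowerInclusion
          (hKoN h12 hZc hQc V p hp5 hgood hap hs) hs (hE V p hp5 hgood hap hs)
      · exact hN₁nc V p hp5 hgood hap hs (EtaRankLeOneLeaf.not_hasCM_twin_of_not_hasCM W p V C hCV hCM) ⟨W, ‹_›, ‹_›, C, hCV, hr⟩

/-- **Agreement: Part LIII §3 = §2 ∘ §1** (the η-form split certificate re-derived through the restricted glue and the `F`-form certificate,
given the descent frame (item 19607, PROVED) and Kobayashi Thm 1.2 (item 19608, held) as route binders). CONDITIONAL; nothing booked.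
[cite: Kobayashi2003, Thm. 1.2 (p. 2), §4 (p. 8)] -/
theorem o5SharpGss_of_closesBinders_of_etaNonCMRankLeOne_of_cmRankOneBSDp'
    (hKoN : PlusKatoDivisibilityBranchOntoIotaOfNamedInputs) (h12 : PublishedInputKobThm12OntoIota)
    (hZc : PublishedInputKobZetaEtaContraOnto) (hQc : PublishedInputKatoThm134ContraOnto) (hE : PlusLowerInclusionSurjBranch)
    (hNnc : ∀ (V : WeierstrassCurve ℚ) [V.IsElliptic] [V.IsGloballyMinimal] (p : ℕ) [Fact p.Prime],
      5 ≤ p → V.HasGoodReductionAtPrime p → V.frobeniusTrace p = 0 →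
      ¬ (∀ m : ℕ, V.HasSurjectiveModNGaloisRep (p ^ m : ℕ)) → ¬ V.HasCM →
      (∃ (W : WeierstrassCurve ℚ) (_ : W.IsElliptic) (_ : W.IsGloballyMinimal) (C : VariableChange ℚ),
          C • W.quadraticTwist ((-1 : ℚ) ^ (p / 2) * p) = V ∧ W.analyticRank ≤ 1) →
      QuadraticBranchPlusEtaMainConjectureAt V p)
    (hdec : EtaDescentFrameNonsurj) (h12n : PublishedInputKobThm12Nonsurj)
    (hO10 : ∀ (W : WeierstrassCurve ℚ) [W.IsElliptic] [W.IsGloballyMinimal] (p : ℕ) [Fact p.Prime],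
      W.HasCM → W.analyticRank = 1 → 5 ≤ p → Addv W p → SubGss W p → MissingPPartAt W p)
    (hS28 : bsdTriple_of_hasCM_of_L_one_ne_zero)
    (h₂ : EtaTransportSigned) (h₄ : PAdicGrossZagierBranch)
    (hP : PublishedInputsGss2) (hKO : PublishedInputKO13) (hR : Gss2AtThree) :
    Summit.BirchSwinnertonDyer.Rank1Residual.Additive.O5SharpGss :=
  o5SharpGss_of_closesBinders_of_nonsurjNonCMRankLeOne_of_cmRankOneBSDp hKoN h12 hZc hQc hE
    (plusMainConjectureNonsurjBranchNonCMRankLeOne_of_eta hNnc hdec h12n) hO10 hS28 h₂ h₄ hP hKO hR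

end EtaRankLeOneLeafGlue

end Summit.BirchSwinnertonDyer.BirchSwinnertonDyer.Theorems

end
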